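import Summits.BirchSwinnertonDyer.BirchSwinnertonDyer.Theorems.Rank2ObservatoryRank3PSatCertC
import Summits.BirchSwinnertonDyer.BirchSwinnertonDyer.Theorems.Rank2ObservatoryLegendreCount
import HarnessLib

/-!
# BirchSwinnertonDyer — rank ≥ 2 observatory: rank-3 `p`-saturation certificates, fast counts

HONEST FRAMING: per-curve certified theorems and census instruments; no claim on BSD in rank ≥ 2.

The DENSE odd-`p` saturation row certificate of `Rank2ObservatoryRank3PSatCertC` (lane `u = 0`,
computed and re-validated witness chains) with ONE change in the row Boolean: the good-prime
point counts of the annihilator list `S` and of the witness list `Q` are checked by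
`killerLB` (`Rank2ObservatoryLegendreCount`: Euler-criterion count, `q` accelerated
`Nat.pow`/`Nat.mod` evaluations per prime) instead of `killerB` (`zmodPointCount`: `q²` evaluations
in `ZMod q`, the dominant kernel cost of the table run measured by cert-2 gen 34: ≈ 4 s/row at
`p = 3`, one count at `q = 89` ≈ 21 s). The row DATUM `Rank3PSatCertC` is unchanged, so staged
data are reusable verbatim; soundness is by reduction to the landed Boolean
(`killerB_of_killerLB`):

* `rank3PSatCheckCL`, `rank3PSatCheckC_of_checkCL`, `Rank3Row.pSaturated_of_pSatCheckCL`;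
* list form `rank3PSatCheckCLAll`, `rank3PSatCheckCAll_of_checkCLAll`,
  `Rank3Row.pSaturated_of_pSatCheckCLAll` — the statement provers/data files cite.

Sorry-free; no `decide` executed in this file.

References: S. Siksek, Rocky Mountain J. Math. 25 (1995) §3; J. E. Cremona, *Algorithms for
Modular Elliptic Curves* (1997) §2.4, §3.5; J. H. Silverman, AEC (2009) VII.3.
-/

-- single-conjunct summit: `Summit.BirchSwinnertonDyer.BirchSwinnertonDyer.…` repeats the name
set_option linter.dupNamespace false

namespace Summit.BirchSwinnertonDyer.BirchSwinnertonDyer.Rank2Observatory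

open WeierstrassCurve

/-- **The dense row Boolean with fast counts** (kernel `decide`): identical to `rank3PSatCheckC`
except that the counts of `S` and `Q` are verified by `killerLB` (Euler's criterion).
[cite: CremonaAlgorithms1997, §3.5] -/
def rank3PSatCheckCL (r : Rank3Row) (p : ℕ) (c : Rank3PSatCertC) : Bool :=
  let V := scaleModel r.intModel c.d
  decide (c.d ≠ 0 ∧ V.Δ ≠ 0 ∧ p.Prime ∧ ¬ (p : ℤ) ∣ (c.t : ℤ) ∧
      c.X₁ * r.P₁.2.2 = c.d ^ 2 * r.P₁.1 ∧ c.Y₁ * r.P₁.2.2 = c.d ^ 3 * r.P₁.2.1 ∧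
      c.X₂ * r.P₂.2.2 = c.d ^ 2 * r.P₂.1 ∧ c.Y₂ * r.P₂.2.2 = c.d ^ 3 * r.P₂.2.1 ∧
      c.X₃ * r.P₃.2.2 = c.d ^ 2 * r.P₃.1 ∧ c.Y₃ * r.P₃.2.2 = c.d ^ 3 * r.P₃.2.1 ∧
      c.Y₁ ^ 2 + V.a₁ * c.X₁ * c.Y₁ + V.a₃ * c.Y₁ =
        c.X₁ ^ 3 + V.a₂ * c.X₁ ^ 2 + V.a₄ * c.X₁ + V.a₆ ∧
      c.Y₂ ^ 2 + V.a₁ * c.X₂ * c.Y₂ + V.a₃ * c.Y₂ =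
        c.X₂ ^ 3 + V.a₂ * c.X₂ ^ 2 + V.a₄ * c.X₂ + V.a₆ ∧
      c.Y₃ ^ 2 + V.a₁ * c.X₃ * c.Y₃ + V.a₃ * c.Y₃ =
        c.X₃ ^ 3 + V.a₂ * c.X₃ ^ 2 + V.a₄ * c.X₃ + V.a₆) &&
  annihilatorCheck c.S c.t && c.S.all (killerLB V) && c.Q.all (killerLB V) &&
  (normTriples p).all fun abc => c.Q.any (pWitnessC V p c.X₁ c.Y₁ c.X₂ c.Y₂ c.X₃ c.Y₃ abc)

/-- The fast Boolean implies the landed dense Boolean (`killerB_of_killerLB` on `S` and `Q`).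
[cite: CremonaAlgorithms1997, §3.5] -/
theorem rank3PSatCheckC_of_checkCL (r : Rank3Row) (p : ℕ) (c : Rank3PSatCertC)
    (h : rank3PSatCheckCL r p c = true) : rank3PSatCheckC r p c = true := by
  unfold rank3PSatCheckCL at h
  unfold rank3PSatCheckC
  simp only [Bool.and_eq_true] at h ⊢
  obtain ⟨⟨⟨⟨hdec, hann⟩, hS⟩, hQ⟩, hall⟩ := h
  exact ⟨⟨⟨⟨hdec, hann⟩, all_killerB_of_all_killerLB _ hS⟩, all_killerB_of_all_killerLB _ hQ⟩, hall⟩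

/-- **SOUNDNESS of the fast dense row certificate**: the listed span `ℤP₁ + ℤP₂ + ℤP₃ + E(ℚ)_tors`
is `p`-SATURATED in `E(ℚ) = r.curve⟮ℚ⟯`. [cite: CremonaAlgorithms1997, §3.5] -/
theorem Rank3Row.pSaturated_of_pSatCheckCL (r : Rank3Row) (h : r.check = true) (p : ℕ)
    (c : Rank3PSatCertC) (hc : rank3PSatCheckCL r p c = true) :
    ∀ a : r.curve.toAffine.Point,
      p • a ∈ AddSubgroup.closure {r.gen₁ h, r.gen₂ h, r.gen₃ h} ⊔ AddCommGroup.torsion _ →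
        a ∈ AddSubgroup.closure {r.gen₁ h, r.gen₂ h, r.gen₃ h} ⊔ AddCommGroup.torsion _ :=
  r.pSaturated_of_pSatCheckC h p c (rank3PSatCheckC_of_checkCL r p c hc)

/-- The fast dense Boolean over a list of rows and certificates (same order). [folklore] -/
def rank3PSatCheckCLAll (p : ℕ) : List Rank3Row → List Rank3PSatCertC → Bool
  | [], _ => true
  | _ :: _, [] => false
  | r :: rs, c :: cs => rank3PSatCheckCL r p c && rank3PSatCheckCLAll p rs cs

/-- List form of the reduction to the landed dense Boolean. [folklore] -/
theorem rank3PSatCheckCAll_of_checkCLAll (p : ℕ) :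
    ∀ {rows : List Rank3Row} {cs : List Rank3PSatCertC},
      rank3PSatCheckCLAll p rows cs = true → rank3PSatCheckCAll p rows cs = true
  | [], _, _ => by simp [rank3PSatCheckCAll]
  | _ :: _, [], hc => by simp [rank3PSatCheckCLAll] at hc
  | r :: rs, c :: cs, hc => by
    rw [rank3PSatCheckCLAll, Bool.and_eq_true] at hc
    rw [rank3PSatCheckCAll, Bool.and_eq_true]
    exact ⟨rank3PSatCheckC_of_checkCL r p c hc.1, rank3PSatCheckCAll_of_checkCLAll p hc.2⟩

/-- **Soundness of the list form, fast dense certificates** — the statement the data files cite.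
[cite: CremonaAlgorithms1997, §3.5] -/
theorem Rank3Row.pSaturated_of_pSatCheckCLAll (p : ℕ) {rows : List Rank3Row}
    {cs : List Rank3PSatCertC} (hc : rank3PSatCheckCLAll p rows cs = true) :
    ∀ r ∈ rows, ∀ h : r.check = true, ∀ a : r.curve.toAffine.Point,
      p • a ∈ AddSubgroup.closure {r.gen₁ h, r.gen₂ h, r.gen₃ h} ⊔ AddCommGroup.torsion _ →
        a ∈ AddSubgroup.closure {r.gen₁ h, r.gen₂ h, r.gen₃ h} ⊔ AddCommGroup.torsion _ :=
  Rank3Row.pSaturated_of_pSatCheckCAll p (rank3PSatCheckCAll_of_checkCLAll p hc)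

end Summit.BirchSwinnertonDyer.BirchSwinnertonDyer.Rank2Observatory
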